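import Mathlib.Analysis.Complex.Convex
import Literature.NumberTheory.LFunctions.DedekindZetaERHProofs
import HarnessLib

/-!
# Crux `QuinticDedekindPole` (stmt-Langlands-17270), line `Sketch`: stub `stub_poleWitness_to_crux`

The pure complex-analysis glue of the TRUE direction of the crux
`Summit.Langlands.Langlands.Theses.DedekindQuotient1951.QuinticDedekindPole`, with the crux
statement written out verbatim as the conclusion (so that this file does not import the route's
Theses module; `QuinticDedekindPole` unfolds to it definitionally): if for every
Doud–Moore-generated number field `K` there is a *pole witness* — a point `ρ ≠ 1` of the box
`B = {0 < re s, |im s| < 100}` with `ζ(ρ) = 0` and `ζ_K^{cont}(ρ) ≠ 0` — then no `g` holomorphic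
on `B` satisfies `g · ζ = ζ_K` on `{1 < re s, |im s| < 100}`.

Proof (identity principle on the open connected set `U = B ∖ {1}`): both `F = g · ζ` and the
continued Dedekind zeta function `ζ_K^{cont} = dedekindZetaCont K` are holomorphic on `U`
(`differentiableAt_riemannZeta`, `differentiableOn_dedekindZetaCont_holds`) and agree on the open
subset `{1 < re s, |im s| < 100} ∋ 2` (there `ζ_K^{cont} = ζ_K`,
`dedekindZetaCont_eq_dedekindZeta_holds`), hence on all of `U` (`AnalyticOnNhd.eqOn_of_preconnected_of_eventuallyEq`; `U` is the union of
the four overlapping convex pieces `B ∩ {1 < re}`, `B ∩ {0 < im}`, `B ∩ {im < 0}`, `B ∩ {re < 1}`,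
hence preconnected), in particular at `ρ ∈ U`, where the left side vanishes and the right side
does not.
-/

set_option linter.dupNamespace false

noncomputable section

open Complex Filter Set
open scoped Topology

namespace Summit.Langlands.Langlands.Theorems.DedekindQuotient1951

open Literature.NumberTheory.LFunctions

/-- **Pole witness ⇒ crux** (box glue, identity principle on the box minus `1`): if for every
Doud–Moore-generated number field `K` some zero `ρ ≠ 1` of `ζ` in the box `0 < re s, |im s| < 100`
has `ζ_K^{cont}(ρ) ≠ 0`, then no `g` holomorphic on the box satisfies `g · ζ = ζ_K` on
`re s > 1, |im s| < 100`: there `ζ_K^{cont} = ζ_K`, so `g · ζ` and `ζ_K^{cont}` agree on an open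
subset of the connected open set box `∖ {1}`, hence at `ρ`, where `g ρ · ζ(ρ) = 0 ≠ ζ_K^{cont}(ρ)`.
[folklore] -/
theorem stub_poleWitness_to_crux
    (hw : ∀ (K : Type) [Field K] [NumberField K] (θ : K),
      θ ^ 5 - θ ^ 4 - 780 * θ ^ 3 + 9911 * θ ^ 2 - 24208 * θ + 15952 = 0 →
      IntermediateField.adjoin ℚ ({θ} : Set K) = ⊤ →
      ∃ ρ : ℂ, 0 < ρ.re ∧ |ρ.im| < 100 ∧ ρ ≠ 1 ∧ riemannZeta ρ = 0 ∧ dedekindZetaCont K ρ ≠ 0) :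
    ∀ (K : Type) [Field K] [NumberField K] (θ : K),
      θ ^ 5 - θ ^ 4 - 780 * θ ^ 3 + 9911 * θ ^ 2 - 24208 * θ + 15952 = 0 →
      IntermediateField.adjoin ℚ ({θ} : Set K) = ⊤ →
      ¬ ∃ g : ℂ → ℂ, DifferentiableOn ℂ g {s : ℂ | 0 < s.re ∧ |s.im| < 100} ∧
        ∀ s : ℂ, 1 < s.re → |s.im| < 100 → g s * riemannZeta s = NumberField.dedekindZeta K s := by
  intro K _ _ θ hθ hgen
  rintro ⟨g, hg, hgζ⟩
  obtain ⟨ρ, hρre, hρim, hρ1, hζρ, hKρ⟩ := hw K θ hθ hgen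
  set B : Set ℂ := {s : ℂ | 0 < s.re ∧ |s.im| < 100} with hB
  -- the box is open and convex, so the box minus `1` is open and preconnected
  have hBo : IsOpen B :=
    (isOpen_lt continuous_const continuous_re).and
      (isOpen_lt (continuous_abs.comp continuous_im) continuous_const)
  have hBc : Convex ℝ B := by
    have hBeq :
        B = {s : ℂ | 0 < s.re} ∩ ({s : ℂ | -100 < s.im} ∩ {s : ℂ | s.im < 100}) := by
      ext s
      simp only [hB, mem_setOf_eq, mem_inter_iff, abs_lt]
    rw [hBeq]
    exact (convex_halfSpace_re_gt 0).inter
      ((convex_halfSpace_im_gt _).inter (convex_halfSpace_im_lt _))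
  have hUo : IsOpen (B \ {1}) := hBo.sdiff isClosed_singleton
  have hUc : IsPreconnected (B \ {1}) := by
    have hUeq : B \ {1} =
        B ∩ {s : ℂ | 1 < s.re} ∪ B ∩ {s : ℂ | 0 < s.im} ∪ B ∩ {s : ℂ | s.im < 0} ∪
          B ∩ {s : ℂ | s.re < 1} := by
      ext s
      simp only [Set.mem_sdiff, mem_singleton_iff, mem_union, mem_inter_iff, mem_setOf_eq]
      constructor
      · rintro ⟨hs, h1⟩
        rcases lt_trichotomy s.re 1 with h | h | h
        · exact Or.inr ⟨hs, h⟩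
        · have him : s.im ≠ 0 := fun him =>
            h1 (Complex.ext (by simpa using h) (by simpa using him))
          rcases him.lt_or_gt with hlt | hgt
          · exact Or.inl (Or.inr ⟨hs, hlt⟩)
          · exact Or.inl (Or.inl (Or.inr ⟨hs, hgt⟩))
        · exact Or.inl (Or.inl (Or.inl ⟨hs, h⟩))
      · rintro (((⟨hs, h⟩ | ⟨hs, h⟩) | ⟨hs, h⟩) | ⟨hs, h⟩)
        · exact ⟨hs, fun h1 => by norm_num [h1] at h⟩
        · exact ⟨hs, fun h1 => by norm_num [h1] at h⟩
        · exact ⟨hs, fun h1 => by norm_num [h1] at h⟩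
        · exact ⟨hs, fun h1 => by norm_num [h1] at h⟩
    rw [hUeq]
    refine (((hBc.inter (convex_halfSpace_re_gt 1)).isPreconnected.union' ⟨2 + I, ?_⟩
      (hBc.inter (convex_halfSpace_im_gt 0)).isPreconnected).union' ⟨2 - I, ?_⟩
      (hBc.inter (convex_halfSpace_im_lt 0)).isPreconnected).union' ⟨((1 : ℝ) / 2 : ℝ) + I, ?_⟩
      (hBc.inter (convex_halfSpace_re_lt 1)).isPreconnected
    all_goals simp only [hB, mem_inter_iff, mem_union, mem_setOf_eq, add_re, sub_re, re_ofNat,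
      I_re, ofReal_re, add_zero, sub_zero, add_im, sub_im, im_ofNat, I_im, ofReal_im, zero_add,
      zero_sub]
    all_goals norm_num
  -- `g · ζ` and `ζ_K^{cont}` are analytic on the box minus `1`
  have hF : AnalyticOnNhd ℂ (fun s => g s * riemannZeta s) (B \ {1}) :=
    ((hg.mono Set.sdiff_subset).mul fun s hs =>
      (differentiableAt_riemannZeta fun h => hs.2 (mem_singleton_iff.2 h)).differentiableWithinAt)
      |>.analyticOnNhd hUo
  have hd : DifferentiableOn ℂ (dedekindZetaCont K) {1}ᶜ :=
    differentiableOn_dedekindZetaCont_holds K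
  have hG : AnalyticOnNhd ℂ (dedekindZetaCont K) (B \ {1}) :=
    (hd.mono fun s hs => hs.2).analyticOnNhd hUo
  -- they agree near `2`
  have h2 : (2 : ℂ) ∈ B \ {1} := by
    refine ⟨⟨?_, ?_⟩, ?_⟩
    · simp
    · simp
    · norm_num
  have heq : (fun s => g s * riemannZeta s) =ᶠ[𝓝 (2 : ℂ)] dedekindZetaCont K := by
    have hVo : IsOpen {s : ℂ | 1 < s.re ∧ |s.im| < 100} :=
      (isOpen_lt continuous_const continuous_re).and
        (isOpen_lt (continuous_abs.comp continuous_im) continuous_const)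
    have h2V : (2 : ℂ) ∈ {s : ℂ | 1 < s.re ∧ |s.im| < 100} := by
      refine ⟨?_, ?_⟩
      · simp only [re_ofNat]; norm_num
      · simp
    filter_upwards [hVo.mem_nhds h2V] with s hs
    rw [hgζ s hs.1 hs.2, dedekindZetaCont_eq_dedekindZeta_holds hs.1]
  -- hence everywhere on the box minus `1`, in particular at `ρ`
  have hEq := hF.eqOn_of_preconnected_of_eventuallyEq hG hUc h2 heq
  have hρU : ρ ∈ B \ {1} := ⟨⟨hρre, hρim⟩, fun h => hρ1 (mem_singleton_iff.1 h)⟩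
  have hρeq : g ρ * riemannZeta ρ = dedekindZetaCont K ρ := hEq hρU
  rw [hζρ, mul_zero] at hρeq
  exact hKρ hρeq.symm

end Summit.Langlands.Langlands.Theorems.DedekindQuotient1951

end
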